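import Summits.ResolutionOfSingularities.ResolutionOfSingularities.Theorems.FrobeniusLadderFRationalResolutionTwoStepChartFactsInterface
import Literature.AlgebraicGeometry.Resolution.FiniteQuotientSingularityPresentation
import HarnessLib

/-!
# Crux `FrobeniusLadder.FRationalResolution` (stmt-ResolutionOfSingularities-15317), line `redirect`,
# stub `stub_diagonalizableQuotientResolution` — THE PER-CHART CERTIFICATE IS TRIVIAL ON A REGULAR CHART

In `…TwoStepChartFactsInterface.chartFacts_of_certificate` / `…MonoidAlgebraModel.hasResolution_of_isolated_fixedPoints_of_monoidAlgebra_certificate`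
(p843406 / p843485) every reduction chart `C = T[J/yⱼ]` must carry a certificate
`∃ G 𝔪 M, (∀ g ∈ G, C[1/g] regular) ∧ 𝔪^M ⊆ 𝔞 + (G) ∧ (C_𝔪 singular → Bl_𝔪 regular)`. When the chart ring `C` is itself a REGULAR
ring (e.g. the pure-power charts `≅ 𝔸ⁿ` of a Veronese cone, `stub_veronese_chart_isRegularRing`), the certificate is free:
`G = {1}`, any maximal `𝔪`, `M = 0`… — precisely: `C[1/1]` is regular, `𝔪^1 ≤ ⊤ = 𝔞 + (1)`, and `C_𝔪` is regular. So real work is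
needed only on the singular vertex charts.

* ★ `certificate_of_isRegularRing` — the certificate on a non-trivial regular chart ring;
* `chartFacts_of_isRegularRing` — directly: no non-regular primes, `hmodel` vacuous.

Honest label: elementary plumbing toward ONE leaf stub (no stub, crux or summit closed). No definitions, no named facts, no sorry.
[folklore; cite: Matsumura1987, Thm. 19.3]
-/

noncomputable section

-- single-problem summit: the doubled namespace component is forced
set_option linter.dupNamespace false

open AlgebraicGeometry IsLocalRing
open Literature.AlgebraicGeometry.Resolution

namespace Summit.ResolutionOfSingularities.ResolutionOfSingularities.Theorems.FRationalResolution.TwoStepChartFactsInterface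

/-- ★ **The per-chart certificate on a REGULAR chart ring is free.** `C` a non-trivial regular ring, `𝔞` any ideal: take `G = {1}`,
any maximal ideal `𝔪`, `M = 1`. [folklore; cite: Matsumura1987, Thm. 19.3] -/
theorem certificate_of_isRegularRing {C : Type} [CommRing C] [Nontrivial C] [IsRegularRing C] (𝔞 : Ideal C) :
    ∃ (G : Set C) (𝔪 : Ideal C) (_ : 𝔪.IsMaximal) (M : ℕ),
      (∀ g ∈ G, IsRegularRing (Localization.Away g)) ∧ 𝔪 ^ M ≤ 𝔞 ⊔ Ideal.span G ∧
      (¬ IsRegularLocalRing (Localization.AtPrime 𝔪) →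
        Scheme.IsRegular (affineBlowup (R := Localization.AtPrime 𝔪) (maximalIdeal (Localization.AtPrime 𝔪)))) := by
  obtain ⟨𝔪, h𝔪⟩ := Ideal.exists_maximal C
  refine ⟨{1}, 𝔪, h𝔪, 1, ?_, ?_, ?_⟩
  · intro g hg
    rw [Set.mem_singleton_iff] at hg
    subst hg
    exact isRegularRing_localization (Submonoid.powers (1 : C))
  · rw [Ideal.span_singleton_one, sup_top_eq]
    exact le_top
  · intro h
    exact absurd (IsRegularRing.isRegularLocalRing_localization 𝔪) h

/-- **No chart facts to check on a regular chart ring**: the set of non-regular primes over `𝔞` is empty and `hmodel` is vacuous.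
[folklore; cite: Matsumura1987, Thm. 19.3] -/
theorem chartFacts_of_isRegularRing {C : Type} [CommRing C] [IsRegularRing C] (𝔞 : Ideal C) :
    {𝔫 : PrimeSpectrum C | 𝔞 ≤ 𝔫.asIdeal ∧ ¬ IsRegularLocalRing (Localization.AtPrime 𝔫.asIdeal)}.Finite ∧
    ∀ 𝔫 : PrimeSpectrum C, 𝔞 ≤ 𝔫.asIdeal → ¬ IsRegularLocalRing (Localization.AtPrime 𝔫.asIdeal) →
      Scheme.IsRegular (affineBlowup (R := Localization.AtPrime 𝔫.asIdeal) (maximalIdeal (Localization.AtPrime 𝔫.asIdeal))) := by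
  refine ⟨?_, fun 𝔫 _ h => absurd (IsRegularRing.isRegularLocalRing_localization 𝔫.asIdeal) h⟩
  convert Set.finite_empty
  ext 𝔫
  simp only [Set.mem_setOf_eq, Set.mem_empty_iff_false, iff_false, not_and, not_not]
  exact fun _ => IsRegularRing.isRegularLocalRing_localization 𝔫.asIdeal

end Summit.ResolutionOfSingularities.ResolutionOfSingularities.Theorems.FRationalResolution.TwoStepChartFactsInterface

end
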